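import Summits.BirchSwinnertonDyer.BirchSwinnertonDyer.Theorems.ClassRecordThreeSchneiderAtThreeStubTight
import Summits.BirchSwinnertonDyer.BirchSwinnertonDyer.Theorems.KolyvaginRoadThreeSchneiderTamAtThreeHeightLogNumeratorCriterion
import Summits.BirchSwinnertonDyer.BirchSwinnertonDyer.Theorems.KolyvaginRoadThreeSchneiderTamAtThreeHeightLogNumeratorSecondOrderCriterion
import Summits.BirchSwinnertonDyer.BirchSwinnertonDyer.Theorems.KolyvaginRoadThreeSchneiderTamAtThreeHeightLogNumeratorDeepRefinedCriterion
import Summits.BirchSwinnertonDyer.BirchSwinnertonDyer.Theorems.KolyvaginRoadThreeSchneiderTamAtThreeExactCrux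
import Summits.BirchSwinnertonDyer.Uniform.UI.O2Binder
import Summits.BirchSwinnertonDyer.Uniform.UI.O2PrincipalUnit
import HarnessLib

/-!
# Crux `SchneiderAtThree` (route `ClassRecordThree`, item 19106) — the TWIN DICTIONARY: the crux by name in
# the currencies of the `3`-adic closed form (ui-o2's Tate–sigma conjecture, `Σ²_E(P) ≠ den x(P)`, one
# certificate per curve, first/second-order and refined-deep NUMERATOR witnesses, numerator towers)

HONEST FRAMING (cell `bsd-stepL`, seat `bsd-stepL-tam3-p2` g4; `--supports stmt-BirchSwinnertonDyer-19106 --as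
helper`): a THIN dictionary file — THEOREMS ONLY, 0 definitions, 0 named facts, 0 sorry. Nothing here proves the
crux, Schneider's conjecture or BSD. The crux `SchneiderAtThree` (Schneider non-degeneracy of THE canonical
non-split-multiplicative `3`-adic height on class X11b@3 ∧ (ram) ∧ ¬split(3)) is OPEN class-wide (barrier
`Literature.Barriers.BirchSwinnertonDyer.PAdicHeightNondegeneracy`; RULING 20 (A) of the cell: blocked-on the
tree conjecture `Summit.BirchSwinnertonDyer.Uniform.UI.O2.TateSigmaIrrationalAtThree`). Every crux-level statement
below is either an EQUIVALENCE (re-typing of the crux) or CONDITIONAL on a hypothesis that is itself a statement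
about infinitely many curves (a conjecture, or one witness per curve). What the file gives item 19106 is exactly the
by-name service its Tamagawa twin 19154 `KolyvaginRoadThree.SchneiderTamAtThree` already has (files
`KolyvaginRoadThreeSchneiderTamAtThreeOfTateSigma` p528884, `…HeightLogNumeratorCriterion` p535029,
`…SecondOrderCrux` p547156, `…DeepCrux` p565271, `…ExactCrux` p574112), routed through lane A's tightness theorem
`SchneiderAtThreeStub.schneiderAtThree_iff_anisotropy` (p501061):

* §1 `schneiderAtThree_iff_uniformSchneiderOnLeverLocusAtThree` — the crux IS, verbatim up to unfolding
  `LeverLocusAt W 3 = (Ram W 3 ∧ (split → 5 ≤ 3))`, cell bsd-uniform's class binder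
  `UI.O2.UniformSchneiderOnLeverLocusAtThree` (an `@[conjecture]` def; no GZK needed for the equivalence);
  `schneiderAtThree_of_tateSigmaIrrational` / `…_of_tateSigmaTranscendental` (⟸ the ui-o2 conjecture + GZK);
  `heightAnisotropicNonsplitAtThree_of_tateSigmaIrrational` (the registered DECIDING STUB of 19106, text verbatim,
  ⟸ the conjecture ALONE).
* §2 `schneiderAtThree_iff_forall_admissible_ne_den`, `…_iff_forall_exists_admissible_ne_den` — crux ⟺
  `Σ²_E(P) ≠ den x(P)` at every (⟺ at one) admissible point of every curve of the locus (mod GZK).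
* §3 `schneiderAtThree_of_num_witnesses`, `…₂`, `…_deep'` — crux ⟸ ONE integer-congruence witness per curve
  (first order `3^{v₃ den x} ∤ (num x)² − 1`; second order `3^{v₃ den x + 1} ∤ c₄(a³ − a) + 2b₂b₄·den x`;
  refined deep `3^{v₃ den x + d} ∤ c₄(a³ − a) + 2(b₂b₄ − 18b₆)·den x`), mod GZK. On lane A's table of record
  (kit j249075, the 690 point-carrying rows of the 723 TRUE-OPEN non-split (ram) X11b@3 classes = EXACTLY this
  crux's tabulated locus) the three witnesses fire on 543 / 650 / 690 rows (kit j285773) — census data, credits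
  nothing class-wide.
* §4 `schneiderAtThree_iff_forall_tower[_of_GZK]` — crux ⟺ no numerator tower `9^{−m} log₃ num x(3^m P)` on the
  locus converges to `κ_E·log_E(P)²`, `κ_E = (C⁻²E₂(q) − b₂)/12`.

References: [SteinWuthrich2013] §4.1 (4.1), §4.2, Conj. 4.1; [Schneider1982PadicHeightI] §1;
[KolyvaginEulerSystems1990] Thm. A; [MazurSteinTate2006] §1; [Bertrand1982] Cor. 2, Problème 1; tree:
`Uniform/UI/O2*.lean` (ui-o2 gens 0–8), `Theorems/ClassRecordThreeSchneiderAtThreeStubTight.lean`, the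
`…HeightLogNumerator*` chain of the twin.
-/

noncomputable section

open scoped Classical
open Filter Topology IsUltrametricDist
open WeierstrassCurve Literature.NumberTheory.EllipticCurves
open Literature.NumberTheory.EllipticCurves.SteinWuthrich2013
open Literature.NumberTheory.EllipticCurves.TateCurve
open Literature.NumberTheory.EllipticCurves.Rank1Residual
open Summit.BirchSwinnertonDyer.Rank1Residual Summit.BirchSwinnertonDyer.Rank1Residual.X11b.ClassClosure
open Summit.BirchSwinnertonDyer.Uniform.UI.O2
open Summit.BirchSwinnertonDyer.Rank1Residual.X11b.RegMult.SchneiderAtThreeStub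
open Summit.BirchSwinnertonDyer.Rank1Residual.X11b.RegMult.HeightLogNumerator

namespace Summit.BirchSwinnertonDyer.Rank1Residual.X11b.RegMult.SchneiderAtThreeNumerator

/-! ### §1 The crux IS ui-o2's class binder; the crux and its deciding stub from the Tate–sigma conjecture -/

section Uniform

/-- **`SchneiderAtThree` ⟺ `UI.O2.UniformSchneiderOnLeverLocusAtThree`** (cell bsd-uniform, seat ui-o2's
class-level binder, an `@[conjecture]` def): both say `ClassX11b W 3 → … → RegulatorNonvanishingAt W 3` for every
globally minimal `W`; the crux's binders `Ram W 3 → ¬split(3) →` are `LeverLocusAt W 3 = (Ram W 3 ∧ (split → 5 ≤ 3))`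
unfolded (`5 ≤ 3` is false). No rank hypothesis. Two cells' open statements are ONE statement.
[cite: Schneider1982PadicHeightI, §1] [cite: SteinWuthrich2013, Conj. 4.1] -/
theorem schneiderAtThree_iff_uniformSchneiderOnLeverLocusAtThree :
    Summit.BirchSwinnertonDyer.BirchSwinnertonDyer.Theses.ClassRecordThree.SchneiderAtThree ↔
      UniformSchneiderOnLeverLocusAtThree := by
  unfold UniformSchneiderOnLeverLocusAtThree
  constructor
  · intro h W _ _ hX hloc
    have hns : ¬ W.HasSplitMultiplicativeReductionAtPrime 3 := fun hsplit ↦ by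
      have h5 := hloc.2 hsplit
      omega
    exact h W hX hloc.1 hns
  · intro h W _ _ hX hram hns
    exact h W hX ⟨hram, fun hsplit ↦ absurd hsplit hns⟩

/-- **Crux ⟸ `TateSigmaIrrationalAtThree` + GZK** (CONDITIONAL; the conjecture is OPEN): ui-o2's K0 theorem
`uniformSchneiderOnLeverLocusAtThree_of_tateSigmaIrrational` read through §1. The twin of
`SchneiderTamOfTateSigma.schneiderTamAtThree_of_tateSigmaIrrational` (p528884).
[cite: SteinWuthrich2013, §4.2, Conj. 4.1] [cite: KolyvaginEulerSystems1990, Thm. A] -/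
theorem schneiderAtThree_of_tateSigmaIrrational (hC : TateSigmaIrrationalAtThree)
    (hGZK : rank_eq_analyticRank_of_analyticRank_le_one) :
    Summit.BirchSwinnertonDyer.BirchSwinnertonDyer.Theses.ClassRecordThree.SchneiderAtThree :=
  schneiderAtThree_iff_uniformSchneiderOnLeverLocusAtThree.mpr
    (uniformSchneiderOnLeverLocusAtThree_of_tateSigmaIrrational hC hGZK)

/-- **Crux ⟸ `TateSigmaTranscendentalAtThree` + GZK** (CONDITIONAL; the strong, Bertrand-type form of the
conjecture). [cite: Bertrand1982, Cor. 2, Problème 1] [cite: KolyvaginEulerSystems1990, Thm. A] -/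
theorem schneiderAtThree_of_tateSigmaTranscendental (hC : TateSigmaTranscendentalAtThree)
    (hGZK : rank_eq_analyticRank_of_analyticRank_le_one) :
    Summit.BirchSwinnertonDyer.BirchSwinnertonDyer.Theses.ClassRecordThree.SchneiderAtThree :=
  schneiderAtThree_of_tateSigmaIrrational (tateSigmaIrrational_of_transcendental hC) hGZK

/-- **The registered DECIDING STUB of 19106 ⟸ the conjecture alone (no GZK).** `stub_heightAnisotropicNonsplitAtThree`
of the BC3 skeleton (sha f6e21e29…; text verbatim as in `SchneiderAtThreeStub.schneiderAtThree_iff_anisotropy`: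
anisotropy of THE non-split datum on points of infinite order, on class X11b@3 ∧ (ram) ∧ ¬split) follows from
`TateSigmaIrrationalAtThree` by ui-o2's `pairing_self_ne_zero_of_tateSigmaIrrational` — anisotropy needs no rank
hypothesis; only the passage to `Reg₃ ≠ 0` (the other stub) needs rank one. CONDITIONAL.
[cite: SteinWuthrich2013, §4.2, Conj. 4.1] [cite: MazurSteinTate2006, §1] -/
theorem heightAnisotropicNonsplitAtThree_of_tateSigmaIrrational (hC : TateSigmaIrrationalAtThree) :
    ∀ (W : WeierstrassCurve ℚ) [W.IsElliptic] [W.IsGloballyMinimal],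
      Summit.BirchSwinnertonDyer.Rank1Residual.ClassX11b W 3 →
      Literature.NumberTheory.EllipticCurves.Rank1Residual.Ram W 3 →
      ¬ W.HasSplitMultiplicativeReductionAtPrime 3 →
      ∀ (q : ℚ_[3]) (Dh : WeierstrassCurve.PAdicHeightData W 3), q ≠ 0 → ‖q‖ < 1 →
        Literature.NumberTheory.EllipticCurves.tateJ q = (W.j : ℚ_[3]) →
        Literature.NumberTheory.EllipticCurves.SteinWuthrich2013.IsMultCanonical Dh q →
        ∀ (P : W.toAffine.Point), ¬ IsOfFinAddOrder P → Dh.pairing P P ≠ 0 :=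
  fun W _ _ hX _ _ _ _ hq0 hq1 hj hDh _ hP ↦
    pairing_self_ne_zero_of_tateSigmaIrrational hC W hX.2.2.1 hq0 hq1 hj hDh hP

end Uniform

/-! ### §2 The crux re-typed: `Σ²_E(P) ≠ den x(P)` on the locus -/

section Avoidance

/-- **CRUX ⟺ `Σ²_E(P) ≠ den x(P)` on every admissible point of the locus** (given GZK by name for
`rank E(ℚ) = 1` on the class): for every globally minimal `W` with `ClassX11b W 3`, a (ram) witness and
non-split multiplicative reduction at `3`, every Tate parameter `q` (`q ≠ 0`, `‖q‖ < 1`, `j(q) = j(W)`) and every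
admissible `P = (x, y)`, the canonical Tate–sigma value squared `Σ²_E(P) = C²σ_q(u(P))²` is not the integer
`den x(P)`. Per curve: ui-o2's `regulatorNonvanishingAt_three_iff_forall_admissible_ne_den` (sign pinned). No
height datum, pairing or regulator remains on the right-hand side. Twin of p528884's
`schneiderTamAtThree_iff_forall_admissible_ne_den`. [cite: SteinWuthrich2013, §4.2, Conj. 4.1]
[cite: Schneider1982PadicHeightI, §1] [cite: KolyvaginEulerSystems1990, Thm. A] -/
theorem schneiderAtThree_iff_forall_admissible_ne_den (hGZK : rank_eq_analyticRank_of_analyticRank_le_one) :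
    Summit.BirchSwinnertonDyer.BirchSwinnertonDyer.Theses.ClassRecordThree.SchneiderAtThree ↔
    ∀ (W : WeierstrassCurve ℚ) [W.IsElliptic] [W.IsGloballyMinimal],
      Summit.BirchSwinnertonDyer.Rank1Residual.ClassX11b W 3 →
      Literature.NumberTheory.EllipticCurves.Rank1Residual.Ram W 3 →
      ¬ W.HasSplitMultiplicativeReductionAtPrime 3 →
      ∀ (q : ℚ_[3]), q ≠ 0 → ‖q‖ < 1 → tateJ q = (W.j : ℚ_[3]) →
      ∀ (x y : ℚ) (h : W.toAffine.Nonsingular x y), W.IsAdmissible 3 (.some x y h) →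
        tateSigmaValueSq W 3 q x y ≠ ((x.den : ℚ) : ℚ_[3]) := by
  constructor
  · intro hcrux W _ _ hX hram hns
    have hr : W.mordellWeilRank = 1 := by rw [(hGZK W hX.1.le).1, hX.1]
    exact (regulatorNonvanishingAt_three_iff_forall_admissible_ne_den hX.2.2.1 hns hr).mp (hcrux W hX hram hns)
  · intro H W _ _ hX hram hns
    have hr : W.mordellWeilRank = 1 := by rw [(hGZK W hX.1.le).1, hX.1]
    exact (regulatorNonvanishingAt_three_iff_forall_admissible_ne_den hX.2.2.1 hns hr).mpr (H W hX hram hns)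

/-- **CRUX ⟺ ONE certificate per curve** (given GZK): `SchneiderAtThree` holds iff EVERY curve of the locus has
SOME Tate parameter `q` and SOME admissible point `P = (x, y)` with `Σ²_E(P) ≠ den x(P)` — the content of one
REG3CERT row of lane A (`Reg3Cert.rung_of_mem_reg3certModels`: 723 ∕ 723 tabulated classes), required for each of
the infinitely many curves of the locus. Twin of p528884's `schneiderTamAtThree_iff_forall_exists_admissible_ne_den`.
[cite: SteinWuthrich2013, §4.2, §7] [cite: KolyvaginEulerSystems1990, Thm. A] -/
theorem schneiderAtThree_iff_forall_exists_admissible_ne_den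
    (hGZK : rank_eq_analyticRank_of_analyticRank_le_one) :
    Summit.BirchSwinnertonDyer.BirchSwinnertonDyer.Theses.ClassRecordThree.SchneiderAtThree ↔
    ∀ (W : WeierstrassCurve ℚ) [W.IsElliptic] [W.IsGloballyMinimal],
      Summit.BirchSwinnertonDyer.Rank1Residual.ClassX11b W 3 →
      Literature.NumberTheory.EllipticCurves.Rank1Residual.Ram W 3 →
      ¬ W.HasSplitMultiplicativeReductionAtPrime 3 →
      ∃ (q : ℚ_[3]), q ≠ 0 ∧ ‖q‖ < 1 ∧ tateJ q = (W.j : ℚ_[3]) ∧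
      ∃ (x y : ℚ) (h : W.toAffine.Nonsingular x y), W.IsAdmissible 3 (.some x y h) ∧
        tateSigmaValueSq W 3 q x y ≠ ((x.den : ℚ) : ℚ_[3]) := by
  constructor
  · intro hcrux W _ _ hX hram hns
    have hr : W.mordellWeilRank = 1 := by rw [(hGZK W hX.1.le).1, hX.1]
    exact (regulatorNonvanishingAt_three_iff_exists_admissible_ne_den hX.2.2.1 hns hr).mp (hcrux W hX hram hns)
  · intro H W _ _ hX hram hns
    have hr : W.mordellWeilRank = 1 := by rw [(hGZK W hX.1.le).1, hX.1]
    exact (regulatorNonvanishingAt_three_iff_exists_admissible_ne_den hX.2.2.1 hns hr).mpr (H W hX hram hns)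

end Avoidance

/-! ### §3 The crux from ONE integer-congruence witness per curve (first order, second order, refined deep) -/

section Witnesses

/-- **`SchneiderAtThree` ⟸ one FIRST-ORDER numerator witness per curve** (given GZK): if every curve of the
crux's locus (`ClassX11b W 3`, (ram), non-split at `3`) has an admissible rational point `(x, y)` with
`3^{v₃(den x)} ∤ (num x)² − 1`, the crux holds — `regulatorNonvanishingAt_three_of_classX11b_of_num_criterion`
(p535029: `‖ĥ₃(P) − log₃ num x‖₃ ≤ ‖x‖₃⁻¹`). CONDITIONAL on `hwit`, a statement about rational points of infinitely
many curves (lane A's tabulated point passes on 543 of 690 rows); the (ram) binder is idle.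
[cite: SteinWuthrich2013, §4.2, Conj. 4.1] [cite: KolyvaginEulerSystems1990, Thm. A] -/
theorem schneiderAtThree_of_num_witnesses (hGZK : rank_eq_analyticRank_of_analyticRank_le_one)
    (hwit : ∀ (W : WeierstrassCurve ℚ) [W.IsElliptic] [W.IsGloballyMinimal],
      Summit.BirchSwinnertonDyer.Rank1Residual.ClassX11b W 3 →
      Literature.NumberTheory.EllipticCurves.Rank1Residual.Ram W 3 →
      ¬ W.HasSplitMultiplicativeReductionAtPrime 3 →
      ∃ (x y : ℚ) (h : W.toAffine.Nonsingular x y), W.IsAdmissible 3 (.some x y h) ∧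
        ¬ ((3 : ℤ) ^ padicValNat 3 x.den ∣ x.num ^ 2 - 1)) :
    Summit.BirchSwinnertonDyer.BirchSwinnertonDyer.Theses.ClassRecordThree.SchneiderAtThree := by
  intro W _ _ hX hram hns
  obtain ⟨x, y, h, hadm, hcrit⟩ := hwit W hX hram hns
  exact regulatorNonvanishingAt_three_of_classX11b_of_num_criterion hGZK W hX hns hadm hcrit

/-- **`SchneiderAtThree` ⟸ one SECOND-ORDER numerator witness per curve** (given GZK): an admissible rational
point `(x, y)` and an integer `N = c₄((num x)³ − num x) + 2b₂b₄·den x` (`b₂, b₄, c₄` of the minimal model) with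
`3^{v₃(den x)+1} ∤ N` on every curve of the locus ⟹ the crux — `regulatorNonvanishingAt_three_of_num_criterion₂`
(p546139: `‖ĥ₃(P) − log₃ num x − (b₂b₄/c₄)·den x/num x‖₃ ≤ 3⁻¹‖x‖₃⁻¹`); contains the first-order witnesses; lane
A's tabulated point passes on 650 of 690 rows. CONDITIONAL on `hwit`.
[cite: SteinWuthrich2013, §4.2, Conj. 4.1] [cite: KolyvaginEulerSystems1990, Thm. A] -/
theorem schneiderAtThree_of_num_witnesses₂ (hGZK : rank_eq_analyticRank_of_analyticRank_le_one)
    (hwit : ∀ (W : WeierstrassCurve ℚ) [W.IsElliptic] [W.IsGloballyMinimal],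
      Summit.BirchSwinnertonDyer.Rank1Residual.ClassX11b W 3 →
      Literature.NumberTheory.EllipticCurves.Rank1Residual.Ram W 3 →
      ¬ W.HasSplitMultiplicativeReductionAtPrime 3 →
      ∃ (x y : ℚ) (h : W.toAffine.Nonsingular x y) (N : ℤ), W.IsAdmissible 3 (.some x y h) ∧
        W.c₄ * ((x.num : ℚ) ^ 3 - x.num) + 2 * W.b₂ * W.b₄ * (x.den : ℚ) = (N : ℚ) ∧
        ¬ ((3 : ℤ) ^ (padicValNat 3 x.den + 1) ∣ N)) :
    Summit.BirchSwinnertonDyer.BirchSwinnertonDyer.Theses.ClassRecordThree.SchneiderAtThree := by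
  intro W _ _ hX hram hns
  obtain ⟨x, y, h, N, hadm, hN, hcrit⟩ := hwit W hX hram hns
  exact regulatorNonvanishingAt_three_of_num_criterion₂ hX.2.2.1 hns (by rw [(hGZK W hX.1.le).1, hX.1]) hadm
    hN hcrit

/-- **`SchneiderAtThree` ⟸ one REFINED-DEEP numerator witness per curve** (given GZK): an admissible rational
point `(x, y)` of level `≥ 2` (`3⁴ ∣ den x`) and integers `d ≤ v₃(den x)`,
`N = c₄((num x)³ − num x) + 2(b₂b₄ − 18b₆)·den x` with `3⁻¹‖1/j‖₃ ≤ 3^{−d}` and `3^{v₃(den x)+d} ∤ N` on every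
curve of the locus ⟹ the crux — `regulatorNonvanishingAt_three_of_num_criterion_deep'` (p563953: the deep law
to precision `2k + min(2k, v₃Δ + 1)`). Lane A's point `Q` or `3Q` passes on 690 of 690 tabulated rows (kit
j285773) — census data; CONDITIONAL on `hwit` class-wide.
[cite: SteinWuthrich2013, §4.2, Conj. 4.1] [cite: KolyvaginEulerSystems1990, Thm. A] -/
theorem schneiderAtThree_of_num_witnesses_deep' (hGZK : rank_eq_analyticRank_of_analyticRank_le_one)
    (hwit : ∀ (W : WeierstrassCurve ℚ) [W.IsElliptic] [W.IsGloballyMinimal],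
      Summit.BirchSwinnertonDyer.Rank1Residual.ClassX11b W 3 →
      Literature.NumberTheory.EllipticCurves.Rank1Residual.Ram W 3 →
      ¬ W.HasSplitMultiplicativeReductionAtPrime 3 →
      ∃ (x y : ℚ) (h : W.toAffine.Nonsingular x y) (d : ℕ) (N : ℤ), W.IsAdmissible 3 (.some x y h) ∧
        4 ≤ padicValNat 3 x.den ∧ d ≤ padicValNat 3 x.den ∧
        3⁻¹ * ‖((W.j : ℚ_[3]))⁻¹‖ ≤ (3 : ℝ) ^ (-(d : ℤ)) ∧
        W.c₄ * ((x.num : ℚ) ^ 3 - x.num) + 2 * (W.b₂ * W.b₄ - 18 * W.b₆) * (x.den : ℚ) = (N : ℚ) ∧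
        ¬ ((3 : ℤ) ^ (padicValNat 3 x.den + d) ∣ N)) :
    Summit.BirchSwinnertonDyer.BirchSwinnertonDyer.Theses.ClassRecordThree.SchneiderAtThree := by
  intro W _ _ hX hram hns
  obtain ⟨x, y, h, d, N, hadm, h4, hd, hjd, hN, hcrit⟩ := hwit W hX hram hns
  exact regulatorNonvanishingAt_three_of_num_criterion_deep' hX.2.2.1 hns (by rw [(hGZK W hX.1.le).1, hX.1])
    hadm h4 hd hjd hN hcrit

end Witnesses

/-! ### §4 The crux in the currency of numerator towers -/

section Towers

/-- **`SchneiderAtThree` ⟺ no numerator tower on the locus converges to `κ_E·log_E(P)²`** (modulo the registered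
rank-one stub `hr` of 19106, = GZK on the class): for every `W/ℚ` globally minimal of class X11b at `3` with a (ram)
witness and non-split multiplicative reduction at `3`, every Tate parameter `q` (`q ≠ 0`, `‖q‖₃ < 1`, `tateJ q = j`)
and canonical datum `Dh` (`IsMultCanonical Dh q`), and every admissible rational point `P = (x, y)`:
`¬ (9^{−m}·log₃ num x(3^m P) → κ_E·log_E(P)²)`, `κ_E = (C⁻²E₂(q) − b₂)/12` (the tower's limit EXISTS for every
admissible point, p575244 `exists_tendsto_numeratorTower`; the crux is that it misses one `3`-adic constant per
curve). Lane A's tightness `schneiderAtThree_iff_anisotropy` + the twin's §27–§28 (p574112).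
[cite: SteinWuthrich2013, §4.2 and Conj. 4.1] [cite: Schneider1982PadicHeightI, §1] -/
theorem schneiderAtThree_iff_forall_tower
    (hr : ∀ (W : WeierstrassCurve ℚ) [W.IsElliptic] [W.IsGloballyMinimal],
      Summit.BirchSwinnertonDyer.Rank1Residual.ClassX11b W 3 → W.mordellWeilRank = 1) :
    Summit.BirchSwinnertonDyer.BirchSwinnertonDyer.Theses.ClassRecordThree.SchneiderAtThree ↔
    ∀ (W : WeierstrassCurve ℚ) [W.IsElliptic] [W.IsGloballyMinimal],
      Summit.BirchSwinnertonDyer.Rank1Residual.ClassX11b W 3 →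
      Literature.NumberTheory.EllipticCurves.Rank1Residual.Ram W 3 →
      ¬ W.HasSplitMultiplicativeReductionAtPrime 3 →
      ∀ (q : ℚ_[3]) (Dh : WeierstrassCurve.PAdicHeightData W 3), q ≠ 0 → ‖q‖ < 1 →
        Literature.NumberTheory.EllipticCurves.tateJ q = (W.j : ℚ_[3]) →
        Literature.NumberTheory.EllipticCurves.SteinWuthrich2013.IsMultCanonical Dh q →
        ∀ (x y : ℚ) (h : W.toAffine.Nonsingular x y), W.IsAdmissible 3 (.some x y h) →
          ¬ Tendsto (fun m : ℕ ↦ ((9 : ℚ_[3]) ^ m)⁻¹ *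
              padicLog 3 (((W.xCoord (3 ^ m • (.some x y h : W.toAffine.Point))).num : ℚ) : ℚ_[3]))
            atTop (𝓝 (((uniformisationScaleSq W 3 q)⁻¹ * (1 - 24 * tateS 1 q) - (W.baseChange ℚ_[3]).b₂) / 12 *
              (W.baseChange ℚ_[3]).padicFormalLog (-(x : ℚ_[3]) / y) ^ 2)) := by
  rw [schneiderAtThree_iff_anisotropy hr]
  refine forall_congr' fun W ↦ forall_congr' fun _ ↦ forall_congr' fun _ ↦ forall_congr' fun hX ↦
    forall_congr' fun _ ↦ forall_congr' fun _ ↦ forall_congr' fun q ↦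
    forall_congr' fun Dh ↦ forall_congr' fun _ ↦ forall_congr' fun hq ↦ forall_congr' fun _ ↦
    forall_congr' fun hDh ↦ ?_
  rw [forall_pairing_self_ne_zero_iff_admissible Dh]
  exact forall_admissible_pairing_ne_zero_iff_towers hX.2.2.1 hq hDh

/-- **The same modulo the named fact GZK** (`rank_eq_analyticRank_of_analyticRank_le_one`, the route's PUB item
19921 `RankEqAnalyticRankLeOne`; `SchneiderAtThreeStub.rankOne_of_GZK`). [cite: KolyvaginEulerSystems1990, Thm. A]
[cite: SteinWuthrich2013, §4.2 and Conj. 4.1] -/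
theorem schneiderAtThree_iff_forall_tower_of_GZK (hGZK : rank_eq_analyticRank_of_analyticRank_le_one) :
    Summit.BirchSwinnertonDyer.BirchSwinnertonDyer.Theses.ClassRecordThree.SchneiderAtThree ↔
    ∀ (W : WeierstrassCurve ℚ) [W.IsElliptic] [W.IsGloballyMinimal],
      Summit.BirchSwinnertonDyer.Rank1Residual.ClassX11b W 3 →
      Literature.NumberTheory.EllipticCurves.Rank1Residual.Ram W 3 →
      ¬ W.HasSplitMultiplicativeReductionAtPrime 3 →
      ∀ (q : ℚ_[3]) (Dh : WeierstrassCurve.PAdicHeightData W 3), q ≠ 0 → ‖q‖ < 1 →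
        Literature.NumberTheory.EllipticCurves.tateJ q = (W.j : ℚ_[3]) →
        Literature.NumberTheory.EllipticCurves.SteinWuthrich2013.IsMultCanonical Dh q →
        ∀ (x y : ℚ) (h : W.toAffine.Nonsingular x y), W.IsAdmissible 3 (.some x y h) →
          ¬ Tendsto (fun m : ℕ ↦ ((9 : ℚ_[3]) ^ m)⁻¹ *
              padicLog 3 (((W.xCoord (3 ^ m • (.some x y h : W.toAffine.Point))).num : ℚ) : ℚ_[3]))
            atTop (𝓝 (((uniformisationScaleSq W 3 q)⁻¹ * (1 - 24 * tateS 1 q) - (W.baseChange ℚ_[3]).b₂) / 12 *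
              (W.baseChange ℚ_[3]).padicFormalLog (-(x : ℚ_[3]) / y) ^ 2)) :=
  schneiderAtThree_iff_forall_tower (rankOne_of_GZK hGZK)

end Towers

/-! ### §5 The two cruxes side by side -/

section Twins

/-- **`SchneiderAtThree` (19106) ⟹ `SchneiderTamAtThree` (19154) ⟹ nothing back**: the Tamagawa twin is the
restriction to the cells `3 ∣ ∏ c_ℓ` (lane A's `schneiderTamAtThree_of_schneiderAtThree`, restated here so that
the dictionary is one import), and conversely `SchneiderAtThree` is `SchneiderTamAtThree` AND Schneider on the
Tamagawa-free cells `¬ 3 ∣ ∏ c_ℓ` of the same locus — the cells where route `KolyvaginRoadThree` needs no height.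
[cite: Schneider1982PadicHeightI, §1] -/
theorem schneiderAtThree_iff_tam_and_tamFree :
    Summit.BirchSwinnertonDyer.BirchSwinnertonDyer.Theses.ClassRecordThree.SchneiderAtThree ↔
    (Summit.BirchSwinnertonDyer.BirchSwinnertonDyer.Theses.KolyvaginRoadThree.SchneiderTamAtThree ∧
      ∀ (W : WeierstrassCurve ℚ) [W.IsElliptic] [W.IsGloballyMinimal],
        Summit.BirchSwinnertonDyer.Rank1Residual.ClassX11b W 3 →
        Literature.NumberTheory.EllipticCurves.Rank1Residual.Ram W 3 →
        ¬ W.HasSplitMultiplicativeReductionAtPrime 3 → ¬ 3 ∣ W.tamagawaProduct →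
        RegulatorNonvanishingAt W 3) := by
  constructor
  · intro h
    exact ⟨fun W _ _ hX hram hns _ ↦ h W hX hram hns, fun W _ _ hX hram hns _ ↦ h W hX hram hns⟩
  · rintro ⟨hT, hF⟩ W _ _ hX hram hns
    by_cases htam : 3 ∣ W.tamagawaProduct
    · exact hT W hX hram hns htam
    · exact hF W hX hram hns htam

end Twins

end Summit.BirchSwinnertonDyer.Rank1Residual.X11b.RegMult.SchneiderAtThreeNumerator

end
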